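/-
Copyright (c) 2026. All rights reserved.
Released under Apache 2.0 license as described in the file LICENSE.
-/
import Mathlib
import Summits.RiemannHypothesis.RiemannHypothesis.Theorems.HandoffLatticeTailZetaSide
import HarnessLib

/-!
# THEOREM F1: a one-zero FLOOR for the lattice tail — quantitative THEOREM P

`HANDOFF/prove-1` gen15, ATTEMPT-22 §8. For `F` Lipschitz on `[0, λ]` (`λ ≥ 1`, constant `L`,
`‖F‖ ≤ M` there), vanishing beyond `λ`, with `∫_0^λ F = 0`; `θ_F = dilationSum λ F`,
`W(γ) := 𝓜(1_{(1/λ,∞)} θ_F)(½ + iγ)` the WINDOW transform (a finite expression in the window data),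
`B` a uniform bound of `‖θ_F‖` (`= Lλ + M` for Lipschitz data, tree Riemann-sum lemma; the file is
stated under the ABSTRACT hypotheses `‖θ_F‖ ≤ B` + Müntz). For every critical zero `½ + iγ` of `ζ`
and every depth `A > 0`:

  `‖W(γ)‖ ≤ 2B·√(e^{-A}/λ) + √(A · T_λ(F))`            (`norm_windowMellin_le`)

(L-M3: `W(γ) = −𝓜θ_tail(γ)`; the part of the tail deeper than `e^{-A}/λ` contributes at most
`B∫_0^{e^{-A}/λ} u^{-1/2} = 2B√(e^{-A}/λ)`; the part of log-depth `≤ A` at most `√A·√T` by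
Cauchy–Schwarz against `du/u`). Consequently (`latticeTail_ge_windowMellin_sq_div`): if
`0 < ‖W(γ)‖ =: w` and `w√λ < 4B`, then

  `T_λ(F) ≥ w² / (8 · log(4B / (w√λ)))`.

This is the one-zero case of idea-1's L-LS floor (IDEAS-prolate §131.2–131.3) with the «fringe»
made explicit and unconditional: RH-free, no (Z-MASS)/(DEPTH) input; the price of not knowing the
depth is the logarithm `log(B/w) ≍ log(1/ε)` in place of the conjectured `log q`. Nothing here bears on
the truth of RH.
-/

noncomputable section

set_option linter.dupNamespace false

open Complex MeasureTheory Set Filter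
open Literature.NumberTheory.LFunctions
open scoped NNReal

namespace Summit.RiemannHypothesis.RiemannHypothesis.Theorems

namespace LatticeUncertainty

variable {lam : ℝ} {F : ℝ → ℂ}

/-- AM–GM to Cauchy–Schwarz: if `X ≤ (tA + T/t)/2` for all `t > 0` (`A > 0`, `T ≥ 0`), then
`X ≤ √(A·T)`. -/
theorem le_sqrt_mul_of_forall_amgm {X A T : ℝ} (hA : 0 < A) (hT : 0 ≤ T)
    (h : ∀ t : ℝ, 0 < t → X ≤ (t * A + T / t) / 2) : X ≤ Real.sqrt (A * T) := by
  rcases hT.lt_or_eq with hT | hT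
  · set u := Real.sqrt (A * T) with hu_def
    have hu : 0 < u := Real.sqrt_pos.mpr (mul_pos hA hT)
    have hu2 : u ^ 2 = A * T := Real.sq_sqrt (by positivity)
    have key := h (u / A) (div_pos hu hA)
    have e1 : u / A * A = u := div_mul_cancel₀ u hA.ne'
    have e2 : T / (u / A) = u := by
      rw [div_div_eq_mul_div, div_eq_iff hu.ne', ← sq, hu2, mul_comm]
    rw [e1, e2] at key
    linarith
  · subst hT
    rw [mul_zero, Real.sqrt_zero]
    refine le_of_not_gt fun hX ↦ ?_
    have := h (X / A) (div_pos hX hA)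
    rw [zero_div, add_zero, div_mul_cancel₀ _ hA.ne'] at this
    linarith

section Floor

variable (hlam : 1 ≤ lam) (hFm : Measurable F) {B : ℝ} (hB : ∀ u, ‖dilationSum lam F u‖ ≤ B)
  (hMuntz : ∀ s : ℂ, 0 < s.re → s ≠ 1 → mellin (dilationSum lam F) s = riemannZeta s * mellin F s)
include hlam hFm hB

omit hlam in
/-- The integrand `u^{s-1} θ_F(u)` on `(0, ∞)` at `s = ½ + iγ`: a.e.-measurable and dominated by
`B u^{-1/2}` on every `(a, b]`, `a ≥ 0`, hence integrable there. -/
theorem integrableOn_cpow_smul_dilationSum (γ : ℝ) {a b : ℝ} (ha : 0 ≤ a) :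
    IntegrableOn (fun u : ℝ ↦ (u : ℂ) ^ ((1 / 2 + γ * I : ℂ) - 1) • dilationSum lam F u)
      (Ioc a b) := by
  have h0 : 0 ≤ B := (norm_nonneg _).trans (hB 0)
  -- dominating function `B · u^{-1/2}`, integrable on `(a, b]` since `-1/2 > -1`
  have hg : IntegrableOn (fun u : ℝ ↦ B * u ^ (-(1 / 2 : ℝ))) (Ioc a b) := by
    have := (intervalIntegral.intervalIntegrable_rpow' (a := a) (b := b)
      (by norm_num : (-1 : ℝ) < -(1 / 2))).1
    exact (this.const_mul _)
  have hc : ContinuousOn (fun u : ℝ ↦ (u : ℂ) ^ ((1 / 2 + γ * I : ℂ) - 1)) (Ioi 0) := fun u hu ↦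
    (continuousAt_ofReal_cpow_const _ _ (Or.inr (ne_of_gt hu))).continuousWithinAt
  refine Integrable.mono' hg ?_ ?_
  · exact ((hc.aestronglyMeasurable measurableSet_Ioi).mono_set
      (Ioc_subset_Ioi_self.trans (Ioi_subset_Ioi ha))).smul
      (measurable_dilationSum hFm lam).aestronglyMeasurable
  · refine (ae_restrict_iff' measurableSet_Ioc).mpr (Eventually.of_forall fun u hu ↦ ?_)
    have hu0 : 0 < u := ha.trans_lt hu.1
    rw [norm_smul, Complex.norm_cpow_eq_rpow_re_of_pos hu0]
    simp only [sub_re, add_re, one_re, div_ofNat_re, mul_re, ofReal_re, I_re, mul_zero, ofReal_im,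
      I_im, mul_one, sub_self, add_zero]
    rw [show (1 / 2 : ℝ) - 1 = -(1 / 2) by norm_num, mul_comm]
    exact mul_le_mul_of_nonneg_right (hB u) (Real.rpow_nonneg hu0.le _)

include hMuntz in
/-- **Master inequality, general depth `η`.** For every critical zero `½ + iγ` and every
`0 < η < 1/λ`: `‖W(γ)‖ ≤ ‖∫_{(0,η]} u^{s-1} θ_F(u) du‖ + √(log(1/(λη)) · T_λ(F))` (`s = ½ + iγ`):
L-M3, the splitting of the tail transform at depth `η`, and Cauchy–Schwarz against `du/u` on
`(η, 1/λ]`. THEOREMS F1/F2/F3 bound the remaining DEEP part in three ways. -/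
theorem norm_windowMellin_le_deep_add {γ : ℝ} (hγ : riemannZeta (1 / 2 + γ * I) = 0) {η : ℝ}
    (hη0 : 0 < η) (hηl : η < 1 / lam) :
    ‖mellin ((Ioi (1 / lam)).indicator (dilationSum lam F)) (1 / 2 + γ * I)‖ ≤
      ‖∫ u in Ioc 0 η, (u : ℂ) ^ ((1 / 2 + γ * I : ℂ) - 1) • dilationSum lam F u‖ +
        Real.sqrt (Real.log (1 / lam / η) * latticeTail lam F) := by
  set s : ℂ := 1 / 2 + γ * I with hs_def
  set θ := dilationSum lam F with hθ
  set A : ℝ := Real.log (1 / lam / η) with hA_def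
  have hlam0 : 0 < lam := by positivity
  have hB0 : 0 ≤ B := (norm_nonneg _).trans (hB 0)
  have hA : 0 < A := Real.log_pos (by rw [lt_div_iff₀ hη0, one_mul]; exact hηl)
  -- norm of the integrand at `s`: `u^{-1/2} ‖θ u‖`
  have hnorm : ∀ u : ℝ, 0 < u → ‖(u : ℂ) ^ (s - 1) • θ u‖ = u ^ (-(1 / 2 : ℝ)) * ‖θ u‖ := by
    intro u hu
    rw [norm_smul, Complex.norm_cpow_eq_rpow_re_of_pos hu]
    simp only [hs_def, sub_re, add_re, one_re, div_ofNat_re, mul_re, ofReal_re, I_re, mul_zero,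
      ofReal_im, I_im, mul_one, sub_self, add_zero]
    norm_num
  -- L-M3: `‖W(γ)‖ = ‖𝓜θ_tail(s)‖`
  have hLM3 := mellin_tail_eq_neg_mellin_window_of_zeta_zero hlam hFm hB hMuntz hγ
  have hW : ‖mellin ((Ioi (1 / lam)).indicator θ) s‖ = ‖mellin ((Ioc 0 (1 / lam)).indicator θ) s‖ := by
    rw [hLM3, norm_neg]
  -- `𝓜θ_tail(s) = ∫_{(0,η]} + ∫_{(η,1/λ]}`
  have hI1 := integrableOn_cpow_smul_dilationSum hFm hB γ (b := η) le_rfl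
  have hI2 := integrableOn_cpow_smul_dilationSum hFm hB γ (b := 1 / lam) hη0.le
  have hsub : Ioc 0 (1 / lam) ⊆ Ioi (0 : ℝ) := Ioc_subset_Ioi_self
  have hsplit : mellin ((Ioc 0 (1 / lam)).indicator θ) s =
      (∫ u in Ioc 0 η, (u : ℂ) ^ (s - 1) • θ u) + ∫ u in Ioc η (1 / lam), (u : ℂ) ^ (s - 1) • θ u := by
    have e1 : mellin ((Ioc 0 (1 / lam)).indicator θ) s =
        ∫ u in Ioc 0 (1 / lam), (u : ℂ) ^ (s - 1) • θ u := by
      rw [mellin, setIntegral_eq_of_subset_of_forall_sdiff_eq_zero measurableSet_Ioi hsub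
        (fun u hu ↦ by rw [indicator_of_notMem hu.2, smul_zero])]
      exact setIntegral_congr_fun measurableSet_Ioc (fun u hu ↦ by rw [indicator_of_mem hu])
    rw [e1, ← Ioc_union_Ioc_eq_Ioc hη0.le hηl.le,
      setIntegral_union (Ioc_disjoint_Ioc_of_le le_rfl) measurableSet_Ioc hI1 hI2]
  -- the part of log-depth `≤ A`: `≤ √(A T)` by AM–GM/Cauchy–Schwarz
  have hθsq : IntegrableOn (fun u ↦ ‖θ u‖ ^ 2) (Ioc 0 (1 / lam)) :=
    Measure.integrableOn_of_bounded (M := B ^ 2) (by simp)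
      (((measurable_dilationSum hFm lam).norm).pow_const 2).aestronglyMeasurable
      (Eventually.of_forall fun u ↦ by
        rw [Real.norm_of_nonneg (by positivity)]
        exact pow_le_pow_left₀ (norm_nonneg _) (hB u) 2)
  set T₂ : ℝ := ∫ u in Ioc η (1 / lam), ‖θ u‖ ^ 2 with hT₂
  have hT₂T : T₂ ≤ latticeTail lam F :=
    setIntegral_mono_set hθsq (Eventually.of_forall fun u ↦ by positivity)
      (Eventually.of_forall (Ioc_subset_Ioc_left hη0.le))
  have hT₂0 : 0 ≤ T₂ := integral_nonneg fun u ↦ by positivity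
  have hshallow : ‖∫ u in Ioc η (1 / lam), (u : ℂ) ^ (s - 1) • θ u‖ ≤ Real.sqrt (A * T₂) := by
    have hX : ‖∫ u in Ioc η (1 / lam), (u : ℂ) ^ (s - 1) • θ u‖ ≤
        ∫ u in Ioc η (1 / lam), u ^ (-(1 / 2 : ℝ)) * ‖θ u‖ := by
      refine (norm_integral_le_integral_norm _).trans (le_of_eq ?_)
      exact setIntegral_congr_fun measurableSet_Ioc fun u hu ↦ hnorm u (hη0.trans hu.1)
    refine le_sqrt_mul_of_forall_amgm hA hT₂0 fun t ht ↦ hX.trans ?_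
    -- pointwise AM–GM `u^{-1/2}‖θ‖ ≤ (t u⁻¹ + ‖θ‖²/t)/2`, integrated
    have hinv : IntegrableOn (fun u : ℝ ↦ u⁻¹) (Ioc η (1 / lam)) :=
      (intervalIntegral.intervalIntegrable_inv (by
        intro u hu; rw [uIcc_of_le hηl.le] at hu; exact (hη0.trans_le hu.1).ne')
        continuousOn_id).1
    have hθsq' : IntegrableOn (fun u ↦ ‖θ u‖ ^ 2) (Ioc η (1 / lam)) :=
      hθsq.mono_set (Ioc_subset_Ioc_left hη0.le)
    have hmono : ∫ u in Ioc η (1 / lam), u ^ (-(1 / 2 : ℝ)) * ‖θ u‖ ≤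
        ∫ u in Ioc η (1 / lam), (t * u⁻¹ + ‖θ u‖ ^ 2 / t) / 2 := by
      refine setIntegral_mono_on ?_ (((hinv.const_mul t).add (hθsq'.div_const t)).div_const 2)
        measurableSet_Ioc fun u hu ↦ ?_
      · have hI2n : IntegrableOn (fun u : ℝ ↦ ‖(u : ℂ) ^ (s - 1) • θ u‖) (Ioc η (1 / lam)) :=
          hI2.norm
        exact hI2n.congr_fun (fun u hu ↦ hnorm u (hη0.trans hu.1)) measurableSet_Ioc
      · have hu0 : 0 < u := hη0.trans hu.1
        have hsq : u ^ (-(1 / 2 : ℝ)) * u ^ (-(1 / 2 : ℝ)) = u⁻¹ := by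
          rw [← Real.rpow_add hu0]; norm_num; rw [Real.rpow_neg_one]
        have key : 0 ≤ (Real.sqrt t * u ^ (-(1 / 2 : ℝ)) - ‖θ u‖ / Real.sqrt t) ^ 2 := sq_nonneg _
        have hst : Real.sqrt t ^ 2 = t := Real.sq_sqrt ht.le
        have hst0 : 0 < Real.sqrt t := Real.sqrt_pos.mpr ht
        have ha2 : (u ^ (-(1 / 2 : ℝ))) ^ 2 = u⁻¹ := by rw [sq]; exact hsq
        have expand : (Real.sqrt t * u ^ (-(1 / 2 : ℝ)) - ‖θ u‖ / Real.sqrt t) ^ 2 =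
            t * u⁻¹ + ‖θ u‖ ^ 2 / t - 2 * (u ^ (-(1 / 2 : ℝ)) * ‖θ u‖) := by
          have e : (Real.sqrt t * u ^ (-(1 / 2 : ℝ)) - ‖θ u‖ / Real.sqrt t) ^ 2 =
              Real.sqrt t ^ 2 * (u ^ (-(1 / 2 : ℝ))) ^ 2 + ‖θ u‖ ^ 2 / Real.sqrt t ^ 2
                - 2 * (u ^ (-(1 / 2 : ℝ)) * ‖θ u‖) := by
            field_simp
            ring
          rw [e, hst, ha2]
        rw [expand] at key
        linarith
    refine hmono.trans (le_of_eq ?_)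
    rw [integral_div, integral_add (hinv.const_mul t) (hθsq'.div_const t), integral_const_mul,
      integral_div, ← hT₂, ← intervalIntegral.integral_of_le hηl.le,
      integral_inv (by
        intro h0; rw [uIcc_of_le hηl.le] at h0; exact (lt_irrefl _ (hη0.trans_le h0.1)).elim),
      hA_def]
  -- assemble
  calc ‖mellin ((Ioi (1 / lam)).indicator θ) s‖
      = ‖mellin ((Ioc 0 (1 / lam)).indicator θ) s‖ := hW
    _ ≤ ‖∫ u in Ioc 0 η, (u : ℂ) ^ (s - 1) • θ u‖ +
          ‖∫ u in Ioc η (1 / lam), (u : ℂ) ^ (s - 1) • θ u‖ := by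
        rw [hsplit]; exact norm_add_le _ _
    _ ≤ ‖∫ u in Ioc 0 η, (u : ℂ) ^ (s - 1) • θ u‖ + Real.sqrt (A * T₂) := by gcongr
    _ ≤ ‖∫ u in Ioc 0 η, (u : ℂ) ^ (s - 1) • θ u‖ + Real.sqrt (A * latticeTail lam F) := by
        gcongr

omit hlam hFm hB in
/-- The norm of the tail integrand at `s = ½ + iγ`: `u^{-1/2} ‖θ_F(u)‖`. -/
theorem norm_cpow_smul_dilationSum (γ : ℝ) {u : ℝ} (hu : 0 < u) :
    ‖(u : ℂ) ^ ((1 / 2 + γ * I : ℂ) - 1) • dilationSum lam F u‖ =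
      u ^ (-(1 / 2 : ℝ)) * ‖dilationSum lam F u‖ := by
  rw [norm_smul, Complex.norm_cpow_eq_rpow_re_of_pos hu]
  simp only [sub_re, add_re, one_re, div_ofNat_re, mul_re, ofReal_re, I_re, mul_zero,
    ofReal_im, I_im, mul_one, sub_self, add_zero]
  norm_num

include hMuntz in
/-- **THEOREM F1 (master inequality).** For every critical zero `½ + iγ` and every `A > 0`:
`‖W(γ)‖ ≤ 2B·√(e^{-A}/λ) + √(A · T_λ(F))` (`B` = the sup bound of `θ_F`), where
`W(γ) = 𝓜(1_{(1/λ,∞)}θ_F)(½+iγ)` is the window transform: the deep part is bounded by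
`B∫_0^η u^{-1/2} = 2B√η`. -/
theorem norm_windowMellin_le {γ : ℝ} (hγ : riemannZeta (1 / 2 + γ * I) = 0) {A : ℝ} (hA : 0 < A) :
    ‖mellin ((Ioi (1 / lam)).indicator (dilationSum lam F)) (1 / 2 + γ * I)‖ ≤
      2 * B * Real.sqrt (Real.exp (-A) / lam) + Real.sqrt (A * latticeTail lam F) := by
  set η : ℝ := Real.exp (-A) / lam with hη_def
  have hlam0 : 0 < lam := by positivity
  have hη0 : 0 < η := by positivity
  have hηl : η < 1 / lam := by
    rw [hη_def, div_lt_div_iff_of_pos_right hlam0]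
    exact Real.exp_lt_one_iff.mpr (by linarith)
  have hlogeta : Real.log (1 / lam / η) = A := by
    rw [hη_def, div_div_eq_mul_div, one_div, inv_mul_eq_div, div_self hlam0.ne', one_div,
      Real.log_inv, Real.log_exp, neg_neg]
  have hmaster := norm_windowMellin_le_deep_add hlam hFm hB hMuntz hγ hη0 hηl
  rw [hlogeta] at hmaster
  -- the deep part: `≤ 2B√η`
  have hdeep : ‖∫ u in Ioc 0 η, (u : ℂ) ^ ((1 / 2 + γ * I : ℂ) - 1) • dilationSum lam F u‖ ≤
      2 * B * Real.sqrt η := by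
    have hg : IntegrableOn (fun u : ℝ ↦ B * u ^ (-(1 / 2 : ℝ))) (Ioc 0 η) :=
      ((intervalIntegral.intervalIntegrable_rpow' (a := 0) (b := η)
        (by norm_num : (-1 : ℝ) < -(1 / 2))).1).const_mul _
    have h1 : ‖∫ u in Ioc 0 η, (u : ℂ) ^ ((1 / 2 + γ * I : ℂ) - 1) • dilationSum lam F u‖ ≤
        ∫ u in Ioc 0 η, B * u ^ (-(1 / 2 : ℝ)) := by
      refine norm_integral_le_of_norm_le hg ?_
      refine (ae_restrict_iff' measurableSet_Ioc).mpr (Eventually.of_forall fun u hu ↦ ?_)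
      rw [norm_cpow_smul_dilationSum γ hu.1, mul_comm]
      exact mul_le_mul_of_nonneg_right (hB u) (Real.rpow_nonneg hu.1.le _)
    have h2 : ∫ u in Ioc 0 η, B * u ^ (-(1 / 2 : ℝ)) = 2 * B * Real.sqrt η := by
      rw [integral_const_mul, ← intervalIntegral.integral_of_le hη0.le,
        integral_rpow (Or.inl (by norm_num)), Real.zero_rpow (by norm_num),
        show (-(1 / 2 : ℝ) + 1) = 1 / 2 by norm_num, Real.sqrt_eq_rpow]
      ring
    exact h1.trans h2.le
  exact hmaster.trans (add_le_add hdeep le_rfl)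

include hMuntz in
/-- **THEOREM F1 (one-zero floor for the lattice tail).** With `w := ‖W(γ)‖ > 0` at a critical
zero and `B` any uniform bound of `‖θ_F‖` (e.g. `Lλ + M` for Lipschitz data), if `w√λ < 4B` then `T_λ(F) ≥ w² / (8 log(4B/(w√λ)))` — RH-free and
explicit; the one-zero case of idea-1's L-LS floor with the fringe term made rigorous. -/
theorem latticeTail_ge_windowMellin_sq_div {γ : ℝ} (hγ : riemannZeta (1 / 2 + γ * I) = 0)
    (hw : 0 < ‖mellin ((Ioi (1 / lam)).indicator (dilationSum lam F)) (1 / 2 + γ * I)‖)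
    (hwB : ‖mellin ((Ioi (1 / lam)).indicator (dilationSum lam F)) (1 / 2 + γ * I)‖ * Real.sqrt lam
      < 4 * B) :
    ‖mellin ((Ioi (1 / lam)).indicator (dilationSum lam F)) (1 / 2 + γ * I)‖ ^ 2 /
        (8 * Real.log (4 * B /
          (‖mellin ((Ioi (1 / lam)).indicator (dilationSum lam F)) (1 / 2 + γ * I)‖ * Real.sqrt lam)))
      ≤ latticeTail lam F := by
  set w := ‖mellin ((Ioi (1 / lam)).indicator (dilationSum lam F)) (1 / 2 + γ * I)‖ with hw_def
  have hlam0 : 0 < lam := by positivity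
  have hsl : 0 < Real.sqrt lam := Real.sqrt_pos.mpr hlam0
  have hB0 : 0 < B := by nlinarith [mul_pos hw hsl]
  set R : ℝ := 4 * B / (w * Real.sqrt lam) with hR
  have hR1 : 1 < R := by rw [hR, one_lt_div (by positivity)]; exact hwB
  set A : ℝ := 2 * Real.log R with hA_def
  have hA : 0 < A := by positivity [Real.log_pos hR1]
  have hmaster := norm_windowMellin_le hlam hFm hB hMuntz hγ hA
  -- with this `A`, the fringe term is exactly `w/2`
  have hfringe : 2 * B * Real.sqrt (Real.exp (-A) / lam) = w / 2 := by
    have hexp : Real.exp (-A) = (R ^ 2)⁻¹ := by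
      rw [hA_def, Real.exp_neg, two_mul, Real.exp_add, Real.exp_log (by positivity), sq]
    rw [hexp, Real.sqrt_div' _ hlam0.le, Real.sqrt_inv, Real.sqrt_sq (by positivity), hR]
    field_simp
    ring
  rw [← hw_def, hfringe] at hmaster
  have hT0 : 0 ≤ latticeTail lam F := integral_nonneg fun u ↦ by positivity
  have h1 : w / 2 ≤ Real.sqrt (A * latticeTail lam F) := by linarith
  have h2 : (w / 2) ^ 2 ≤ A * latticeTail lam F := by
    calc (w / 2) ^ 2 ≤ Real.sqrt (A * latticeTail lam F) ^ 2 := by gcongr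
      _ = A * latticeTail lam F := Real.sq_sqrt (by positivity)
  have hlogR : 0 < Real.log R := Real.log_pos hR1
  rw [div_le_iff₀ (by positivity), show (8 : ℝ) * Real.log R = 4 * A by rw [hA_def]; ring]
  nlinarith

end Floor

end LatticeUncertainty

end Summit.RiemannHypothesis.RiemannHypothesis.Theorems
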